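import Summits.QuantumFields.YangMills.Theorems.BalabanUVNodesN11Thm2AlongSupplyChainUpperHalf

/-!
# DAG node N11 — DEFINITIONS: THEOREM 2's §3 SUPPLY, NAMED — the two displayed hypothesis families of g2's producer `thm2Printed_keyed_of_sect3Sentences` ([III] §3's analysis
# of 𝐄: (3.65) + (3.67) per point; of 𝐑: p. 283 per domain), keyed to a witness family `𝒯` and a configuration class `𝒰`, as TWO TOKENS (`structure … : Prop`) `Thm2ESupplyAt θ p 𝒯 𝒰 b cE` ∕
# `Thm2RSupplyAt θ p 𝒯 𝒰 κ cR κ₀`; Theorem 2 keyed and the chain's (2.49) edge read through the names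

Cell `pub-ymgap`, YM-PLAN Track A (HUMAN RULING D-0062 ∕ D-0149), seat `pub-ymgap-dag-n11-w2` (g2), route `BalabanUVNodes`, key item K1⁷ `StabilityBAtRecordR13SepCoPH` =
stmt-QuantumFields-20542; DEFINITION lane (`--kind definition --supports 20542 --as helper`), count-neutral.  [III] = [Balaban1988Convergent].  Over g2's `…Thm2OfRecordKeyed`
(`ineq243_keyed_of_sect3E`, `ineq244_keyed_of_sect3R`), `…Thm2AlongSupplyChain` ∕ `…AtBackgrounds` ∕ `…UpperHalf` (the chain edges), dag-n11-e's obligations (p595576).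

WHY THIS FILE.  g2's producer displays [III] §3's analysis as two forty-line hypothesis families (per datum `(k ≤ K, s, U ∈ 𝒰 k s)`, per scale `j`: a (3.65) partition of `φ_j(s)`
with (3.67) per point, exponent `5 − b`, ONE constant `cE`; a chosen cube per (2.30)-domain inside `Γ_{sc}(s)` with p. 283's bound, ONE `cR`, `κ ≥ κ₀(4·2^d, 2d)`) and every consumer
along the chain re-spells them or carries `B14.Thm2Printed` keyed.  As dag-n11-e's `…Sect3SupplyChainObligationsDefs` did for Theorem 1's hand-over list, THIS FILE NAMES the two
families once, VERBATIM (`Iff.rfl` faces), so that «Theorem 2's §3 supply for the chain's own terms» — the content the node's 𝐓-step supplier owes BEYOND `SupplierObligations` (whose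
`newE` are the (2.28)-type laws, not (3.67)) — is ONE token per side in every statement.

WHAT THIS FILE DEFINES ∕ PROVES (2 `structure … : Prop` + faces + compositions; 0 `sorry`, standard axioms; no `instance`, no `notation`).
§1 `structure Thm2ESupplyAt θ p 𝒯 𝒰 b cE : Prop` (fields `nonneg`, `perPoint` — the E-side family, verbatim) · `structure Thm2RSupplyAt θ p 𝒯 𝒰 κ cR κ₀ : Prop` (fields `nonneg`, `kappa_le`,
   `perDomain` — the R-side family, verbatim) · `thm2ESupplyAt_iff` · `thm2RSupplyAt_iff` (the conjunction forms) · `thm2ESupplyAt_mono ∕ thm2RSupplyAt_mono` (shrinking the class).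
§2 through the names: `ineq243_keyed_of_eSupply` · `ineq244_keyed_of_rSupply` · ★ `thm2Printed_keyed_of_supply` (ONE run: `Thm2ESupplyAt … (1 − β) cE` + `Thm2RSupplyAt … κ cR κ₀` + `1 ≤ M`
   + `g_j ≥ 0` ⇒ `B14.Thm2Printed H033 (fun _ : PUnit ↦ sect2DataOfRecord₁₃Keyed θ p 𝒯 𝒰) F.L β κ₀`) · ★★ `ineq249_action23_chainWitness_of_supply_of_obligations` (the chain's
   (2.49) edge with Theorem 2 keyed REPLACED by the two supply tokens at the chain witness: `(hσ, hT)` + provisos + `Thm2ESupplyAt ∕ Thm2RSupplyAt` at `𝒯 = chain witness` +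
   (2.41)(ii)-regular class + guards ⇒ ∃ E₁ R₁ ≥ 0, ∀ data, (2.46)'s inputs → vacuum → (2.49)) · ★★ `action23_chainWitness_le_of_supply_of_obligations` (its constant-coupling
   upper half, dag-n13-w3's `h249up` currency).
§3 A6: `thm2ESupplyAt_empty ∕ thm2RSupplyAt_empty` (at the EMPTY class both tokens hold trivially — consistency of the tokens as propositions; the honest inhabitant at a
   non-empty class is §3's analysis itself, nobody's theorem: LOCATED).

HONEST FRAMING.  Definitions naming displayed hypotheses + kernel composition; NOTHING of Bałaban asserted — the two tokens ARE [III] §3's proof of Theorem 2 for the witness's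
terms, the supplier's content; N11 NOT discharged; K1⁷ NOT closed; counts unmoved (typed 28∕28 · discharged 5∕27).  One finite four-torus programme at fixed `ε = L^{−K}`; R4 closes
only the conditional finite-𝕋⁴ rung `BalabanLadder.UV`; NOT ℝ⁴, NOT OS, NOT the Yang–Mills mass gap (Clay), which none of this proves.
Sources: [III] Thm 2 (2.43)–(2.44) p.263, (3.65)–(3.67) p.283, p.283 (𝐑-side), (2.45)–(2.49) pp.263–264, (2.30) p.260, §3 p.279.
-/

noncomputable section

open scoped BigOperators Matrix.Norms.L2Operator

namespace Summit.QuantumFields.YangMills.Theorems.BalabanUVNodesN11Thm2SupplyDefs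

open Literature.MathematicalPhysics.QuantumFieldTheory.Balaban1983to89 Step B14.Eq225Concrete B14.LocalCoupling B14Thm2 B12TreeDecay TreeLengthTorus Finset
open T4Continuum Node00 B15DeterminingSets
open B10Eq38TorusDomains (toFine)
open B14.Eq213MaximalDomains (side)
open BalabanUVNodesN11Sect3SupplyChainDefs (Sect3Supplier chainWitness)
open BalabanUVNodesN11Sect3SupplyChainObligationsDefs (SupplierObligations NoExpansionObligation)
open BalabanUVNodesN11Thm2Sect2DataOfRecordKeyedDefs (sect2DataOfRecord₁₃Keyed)
open BalabanUVNodesN11Thm2OfRecordKeyed (ineq243_keyed_of_sect3E ineq244_keyed_of_sect3R)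
open BalabanUVNodesN11Thm2AlongSupplyChain (ineq249_action23_chainWitness_of_obligations)
open BalabanUVNodesN11Thm2AlongSupplyChainUpperHalf (action23_chainWitness_le_of_obligations)

variable {F : T4Family} {N : ℕ} [NeZero N]
variable (θ : Stage13HParams F N) (p : B12.RunParams)
variable (𝒯 : (k : ℕ) → SeqOfRecord F θ.ν θ.τ9.M (gOfRecord₁₃ F N θ.toStage13Params p) p.K k → Sect2.TermValues (F.P p.K) (MatA N) (FluctV N) θ.τ9.M)
variable (𝒰 : (k : ℕ) → SeqOfRecord F θ.ν θ.τ9.M (gOfRecord₁₃ F N θ.toStage13Params p) p.K k → Set (GaugeField (F.P p.K) 0 (SU N)))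

/-! ## §1. The two supply tokens -/

open Classical in
/-- **THEOREM 2's 𝐄-SIDE §3 SUPPLY for the witness family `𝒯` on the class `𝒰`**, exponent `5 − b`, ONE constant `cE ≥ 0`: at every datum `(k ≤ K, s, U ∈ 𝒰 k s)` and scale
`1 ≤ j ≤ k`, a (3.65) partition `φ_j(s) = Σ_{z∈Z} h_z` whose points exhaust the (2.26)–(2.27) range and lie in `Ω_j(s)`, with (3.67) per point `z` of scale `n` (`z ∈ Γ_n(s)`):
`|Σ_X adm·Re[𝐄^{(j)}(X,U,z) − 𝐄^{(j)}(X,1,z)] − β_j·A(h_z, U)| ≤ cE·(L^{j−n})^{5−b}` — the hypothesis `hE` of g2's `ineq243_keyed_of_sect3E`, VERBATIM.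
[cite: Balaban1988Convergent, (3.65)–(3.67) p.283, Thm 2 (2.43) p.263] -/
structure Thm2ESupplyAt (b cE : ℝ) : Prop where
  /-- the constant of (3.67) is non-negative -/
  nonneg : 0 ≤ cE
  /-- (3.65) + (3.67) per point at every datum and scale -/
  perPoint : ∀ k, k ≤ p.K → ∀ (s : SeqOfRecord F θ.ν θ.τ9.M (gOfRecord₁₃ F N θ.toStage13Params p) p.K k) (U : GaugeField (F.P p.K) 0 (SU N)), U ∈ 𝒰 k s →
    ∀ j, 1 ≤ j → j ≤ k → ∃ (Z : Finset (Site (F.P p.K) j)) (h : Site (F.P p.K) j → Plaq (F.P p.K) 0 → ℝ),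
      (∀ q, θ.Phih p k s.Ω s.Λ j q = ∑ z ∈ Z, h z q) ∧
      (∀ z, z ∉ Z → ∀ X, Sect2.admE (F.P p.K) θ.ν θ.τ9.M (gOfRecord₁₃ F N θ.toStage13Params p) s.Λ j (Sect2.domSites (F.P p.K) θ.τ9.M j X) z = false) ∧
      (∀ z ∈ Z, toFine j z ∈ s.Ω j) ∧
      (∀ z ∈ Z, ∀ n, j ≤ n → n ≤ k → toFine j z ∈ gammaRegion s.Ω k n →
        |(∑ X : (Sect2.domSys (F.P p.K) θ.τ9.M j).Dom,
            (if Sect2.admE (F.P p.K) θ.ν θ.τ9.M (gOfRecord₁₃ F N θ.toStage13Params p) s.Λ j (Sect2.domSites (F.P p.K) θ.τ9.M j X) z then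
              (((𝒯 k s).E j X z (gOfRecord₁₃ F N θ.toStage13Params p (j - 1)) (Sect2.ofBackgroundC (ιSU N) U)).re -
                ((𝒯 k s).E j X z (gOfRecord₁₃ F N θ.toStage13Params p (j - 1)) (Sect2.ofBackgroundC (ιSU N) 1)).re) else 0))
          - (1 / gOfRecord₁₃ F N θ.toStage13Params p (j - 1) ^ 2 - 1 / gOfRecord₁₃ F N θ.toStage13Params p j ^ 2) * smearedWilson (h z) U| ≤
          cE * (((F.P p.K).L : ℝ) ^ ((j : ℝ) - n)) ^ (5 - b))

open Classical in
/-- **THEOREM 2's 𝐑-SIDE §3 SUPPLY for the witness family `𝒯` on the class `𝒰`**, ONE constant `cR ≥ 0`, decay `κ ≥ κ₀(4·2^d, 2d)`, power `κ₀`: at every datum and scale every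
(2.30)-admissible `X ∈ 𝐃_j` carries a chosen cube `pick X ∈ X` of a scale `sc ∈ [j, k]` inside `Γ_{sc}(s)` with p. 283's bound «O(1)(LʲL⁻ⁿ)⁴ g_j^{κ₀} exp(−κ d_j(X))» — the hypothesis
`hR` of g2's `ineq244_keyed_of_sect3R`, VERBATIM (with its two side conditions). [cite: Balaban1988Convergent, p.283, Thm 2 (2.44) p.263, (2.30) p.260] -/
structure Thm2RSupplyAt (κ cR : ℝ) (κ₀ : ℕ) : Prop where
  /-- the constant of p. 283 is non-negative -/
  nonneg : 0 ≤ cR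
  /-- the decay rate dominates [II] (1.26)'s threshold on the torus -/
  kappa_le : kappa₀ (4 * 2 ^ (F.P p.K).d) (2 * (F.P p.K).d) ≤ κ
  /-- p. 283 per domain at every datum and scale -/
  perDomain : ∀ k, k ≤ p.K → ∀ (s : SeqOfRecord F θ.ν θ.τ9.M (gOfRecord₁₃ F N θ.toStage13Params p) p.K k) (U : GaugeField (F.P p.K) 0 (SU N)), U ∈ 𝒰 k s →
    ∀ j, 1 ≤ j → j ≤ k →
      ∃ (pick : (Sect2.domSys (F.P p.K) θ.τ9.M j).Dom → TPt (F.P p.K).d (Sect2.domCount (F.P p.K) θ.τ9.M j))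
        (sc : TPt (F.P p.K).d (Sect2.domCount (F.P p.K) θ.τ9.M j) → ℕ),
        (∀ X, Sect2.admR (F.P p.K) θ.ν θ.τ9.M (gOfRecord₁₃ F N θ.toStage13Params p) s.Λ j (Sect2.domSites (F.P p.K) θ.τ9.M j X) = true →
          pick X ∈ X.1 ∧ (j ≤ sc (pick X) ∧ sc (pick X) ≤ k) ∧
            cubeEnl (F.P p.K) (side (F.P p.K).L θ.τ9.M j) (Sect2.liftIdx (F.P p.K) (pick X)) 0 ⊆ gammaRegion s.Ω k (sc (pick X)) ∧
            |((𝒯 k s).R j X (Sect2.ofBackgroundC (ιSU N) U)).re - ((𝒯 k s).R j X (Sect2.ofBackgroundC (ιSU N) 1)).re| ≤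
              cR * (((F.P p.K).L : ℝ) ^ ((j : ℝ) - sc (pick X))) ^ 4 * (gOfRecord₁₃ F N θ.toStage13Params p j) ^ κ₀ *
                Real.exp (-κ * (Sect2.domSys (F.P p.K) θ.τ9.M j).dj X))

open Classical in
/-- `Thm2ESupplyAt` IS the displayed family (conjunction form). [cite: Balaban1988Convergent, (3.67) p.283 (bookkeeping)] -/
theorem thm2ESupplyAt_iff (b cE : ℝ) :
    Thm2ESupplyAt θ p 𝒯 𝒰 b cE ↔
      0 ≤ cE ∧
      ∀ k, k ≤ p.K → ∀ (s : SeqOfRecord F θ.ν θ.τ9.M (gOfRecord₁₃ F N θ.toStage13Params p) p.K k) (U : GaugeField (F.P p.K) 0 (SU N)), U ∈ 𝒰 k s →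
        ∀ j, 1 ≤ j → j ≤ k → ∃ (Z : Finset (Site (F.P p.K) j)) (h : Site (F.P p.K) j → Plaq (F.P p.K) 0 → ℝ),
          (∀ q, θ.Phih p k s.Ω s.Λ j q = ∑ z ∈ Z, h z q) ∧
          (∀ z, z ∉ Z → ∀ X, Sect2.admE (F.P p.K) θ.ν θ.τ9.M (gOfRecord₁₃ F N θ.toStage13Params p) s.Λ j (Sect2.domSites (F.P p.K) θ.τ9.M j X) z = false) ∧
          (∀ z ∈ Z, toFine j z ∈ s.Ω j) ∧
          (∀ z ∈ Z, ∀ n, j ≤ n → n ≤ k → toFine j z ∈ gammaRegion s.Ω k n →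
            |(∑ X : (Sect2.domSys (F.P p.K) θ.τ9.M j).Dom,
                (if Sect2.admE (F.P p.K) θ.ν θ.τ9.M (gOfRecord₁₃ F N θ.toStage13Params p) s.Λ j (Sect2.domSites (F.P p.K) θ.τ9.M j X) z then
                  (((𝒯 k s).E j X z (gOfRecord₁₃ F N θ.toStage13Params p (j - 1)) (Sect2.ofBackgroundC (ιSU N) U)).re -
                    ((𝒯 k s).E j X z (gOfRecord₁₃ F N θ.toStage13Params p (j - 1)) (Sect2.ofBackgroundC (ιSU N) 1)).re) else 0))
              - (1 / gOfRecord₁₃ F N θ.toStage13Params p (j - 1) ^ 2 - 1 / gOfRecord₁₃ F N θ.toStage13Params p j ^ 2) * smearedWilson (h z) U| ≤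
              cE * (((F.P p.K).L : ℝ) ^ ((j : ℝ) - n)) ^ (5 - b)) :=
  ⟨fun h => ⟨h.nonneg, h.perPoint⟩, fun h => ⟨h.1, h.2⟩⟩

open Classical in
/-- `Thm2RSupplyAt` IS the displayed family (conjunction form). [cite: Balaban1988Convergent, p.283 (bookkeeping)] -/
theorem thm2RSupplyAt_iff (κ cR : ℝ) (κ₀ : ℕ) :
    Thm2RSupplyAt θ p 𝒯 𝒰 κ cR κ₀ ↔
      0 ≤ cR ∧ kappa₀ (4 * 2 ^ (F.P p.K).d) (2 * (F.P p.K).d) ≤ κ ∧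
      ∀ k, k ≤ p.K → ∀ (s : SeqOfRecord F θ.ν θ.τ9.M (gOfRecord₁₃ F N θ.toStage13Params p) p.K k) (U : GaugeField (F.P p.K) 0 (SU N)), U ∈ 𝒰 k s →
        ∀ j, 1 ≤ j → j ≤ k →
          ∃ (pick : (Sect2.domSys (F.P p.K) θ.τ9.M j).Dom → TPt (F.P p.K).d (Sect2.domCount (F.P p.K) θ.τ9.M j))
            (sc : TPt (F.P p.K).d (Sect2.domCount (F.P p.K) θ.τ9.M j) → ℕ),
            (∀ X, Sect2.admR (F.P p.K) θ.ν θ.τ9.M (gOfRecord₁₃ F N θ.toStage13Params p) s.Λ j (Sect2.domSites (F.P p.K) θ.τ9.M j X) = true →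
              pick X ∈ X.1 ∧ (j ≤ sc (pick X) ∧ sc (pick X) ≤ k) ∧
                cubeEnl (F.P p.K) (side (F.P p.K).L θ.τ9.M j) (Sect2.liftIdx (F.P p.K) (pick X)) 0 ⊆ gammaRegion s.Ω k (sc (pick X)) ∧
                |((𝒯 k s).R j X (Sect2.ofBackgroundC (ιSU N) U)).re - ((𝒯 k s).R j X (Sect2.ofBackgroundC (ιSU N) 1)).re| ≤
                  cR * (((F.P p.K).L : ℝ) ^ ((j : ℝ) - sc (pick X))) ^ 4 * (gOfRecord₁₃ F N θ.toStage13Params p j) ^ κ₀ *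
                    Real.exp (-κ * (Sect2.domSys (F.P p.K) θ.τ9.M j).dj X)) :=
  ⟨fun h => ⟨h.nonneg, h.kappa_le, h.perDomain⟩, fun h => ⟨h.1, h.2.1, h.2.2⟩⟩

variable {θ p 𝒯 𝒰}

/-- Shrinking the class preserves the 𝐄-side supply. [cite: Balaban1988Convergent, (3.67) p.283 (bookkeeping)] -/
theorem thm2ESupplyAt_mono {𝒰' : (k : ℕ) → SeqOfRecord F θ.ν θ.τ9.M (gOfRecord₁₃ F N θ.toStage13Params p) p.K k → Set (GaugeField (F.P p.K) 0 (SU N))}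
    (hsub : ∀ k s, 𝒰' k s ⊆ 𝒰 k s) {b cE : ℝ} (h : Thm2ESupplyAt θ p 𝒯 𝒰 b cE) : Thm2ESupplyAt θ p 𝒯 𝒰' b cE :=
  ⟨h.nonneg, fun k hk s U hU => h.perPoint k hk s U (hsub k s hU)⟩

/-- Shrinking the class preserves the 𝐑-side supply. [cite: Balaban1988Convergent, p.283 (bookkeeping)] -/
theorem thm2RSupplyAt_mono {𝒰' : (k : ℕ) → SeqOfRecord F θ.ν θ.τ9.M (gOfRecord₁₃ F N θ.toStage13Params p) p.K k → Set (GaugeField (F.P p.K) 0 (SU N))}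
    (hsub : ∀ k s, 𝒰' k s ⊆ 𝒰 k s) {κ cR : ℝ} {κ₀ : ℕ} (h : Thm2RSupplyAt θ p 𝒯 𝒰 κ cR κ₀) : Thm2RSupplyAt θ p 𝒯 𝒰' κ cR κ₀ :=
  ⟨h.nonneg, h.kappa_le, fun k hk s U hU => h.perDomain k hk s U (hsub k s hU)⟩

/-! ## §2. Theorem 2 keyed and the chain's (2.49) edge through the names -/

variable (θ p 𝒯 𝒰)

/-- **(2.43) on the keyed carrier from the 𝐄-side token** (g2's `ineq243_keyed_of_sect3E`). [cite: Balaban1988Convergent, Thm 2 (2.43) p.263, (3.65)–(3.67) p.283] -/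
theorem ineq243_keyed_of_eSupply {b cE : ℝ} (h : Thm2ESupplyAt θ p 𝒯 𝒰 b cE) :
    Ineq243 (sect2DataOfRecord₁₃Keyed θ p 𝒯 𝒰) ((F.P p.K).L : ℝ) (1 - b) cE :=
  ineq243_keyed_of_sect3E θ p 𝒯 𝒰 h.nonneg h.perPoint

/-- **(2.44) on the keyed carrier from the 𝐑-side token** (g2's `ineq244_keyed_of_sect3R`; `1 ≤ M`, couplings `≥ 0`). [cite: Balaban1988Convergent, Thm 2 (2.44) p.263, p.283] -/
theorem ineq244_keyed_of_rSupply (hM : 1 ≤ θ.τ9.M) (hg : ∀ j, j ≤ p.K → 0 ≤ gOfRecord₁₃ F N θ.toStage13Params p j) {κ cR : ℝ} {κ₀ : ℕ}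
    (h : Thm2RSupplyAt θ p 𝒯 𝒰 κ cR κ₀) :
    Ineq244 (sect2DataOfRecord₁₃Keyed θ p 𝒯 𝒰) (cR * K₀ (4 * 2 ^ (F.P p.K).d) (2 * (F.P p.K).d)) κ₀ :=
  ineq244_keyed_of_sect3R θ p 𝒯 𝒰 hM hg h.nonneg h.kappa_le h.perDomain

/-- **★ THEOREM 2 KEYED, ONE RUN, FROM THE TWO SUPPLY TOKENS** (`Thm2ESupplyAt … (1 − β) cE` — «The constant E₁ depends on β also» —, `Thm2RSupplyAt … κ cR κ₀`, `1 ≤ M`, couplings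
`≥ 0`): `B14.Thm2Printed H033 (fun _ : PUnit ↦ sect2DataOfRecord₁₃Keyed θ p 𝒯 𝒰) F.L β κ₀` with `E₁ = cE`, `R₁ = cR·K₀(4·2^d, 2d)`. [cite: Balaban1988Convergent, Thm 2 (2.43)–(2.44) p.263] -/
theorem thm2Printed_keyed_of_supply (H033 : Flow → ℕ → Prop) {β cE κ cR : ℝ} {κ₀ : ℕ} (hM : 1 ≤ θ.τ9.M)
    (hg : ∀ j, j ≤ p.K → 0 ≤ gOfRecord₁₃ F N θ.toStage13Params p j)
    (hE : Thm2ESupplyAt θ p 𝒯 𝒰 (1 - β) cE) (hR : Thm2RSupplyAt θ p 𝒯 𝒰 κ cR κ₀) :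
    B14.Thm2Printed H033 (fun _ : PUnit => sect2DataOfRecord₁₃Keyed θ p 𝒯 𝒰) ((F.P p.K).L : ℝ) β κ₀ := by
  intro _
  refine ⟨cE, cR * K₀ (4 * 2 ^ (F.P p.K).d) (2 * (F.P p.K).d), fun _ _ _ => ⟨?_, ineq244_keyed_of_rSupply θ p 𝒯 𝒰 hM hg hR⟩⟩
  have h := ineq243_keyed_of_eSupply θ p 𝒯 𝒰 hE
  rw [sub_sub_cancel] at h
  exact h

open Classical in
/-- **★★ THE CHAIN's (2.49) EDGE FROM THE SUPPLY TOKENS AT THE CHAIN WITNESS** (g2's `ineq249_action23_chainWitness_of_obligations` with Theorem 2 keyed PRODUCED from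
`Thm2ESupplyAt ∕ Thm2RSupplyAt` at `𝒯 = fun k s ↦ (chainWitness θ p σ k).1 s`): `(hσ, hT)` + def-T's provisos + the two tokens + a (2.41)(ii)-regular class + `0 < β < 1`, `κ₀ ≥ 7`,
`H033`, couplings `≥ 0`, `κ₀(4·2^d,2d) ≤ θ.s2.lf.κ` ⇒ `∃ E₁ R₁ ≥ 0`, ∀ `k ≤ K`, `s`, `U ∈ 𝒰 k s`, volumes, (2.46)'s inputs, vacuum ⇒ (2.49) for the chain's (2.23)-action (`L = F.L`).
[cite: Balaban1988Convergent, Thm 1 p.262, Thm 2 p.263, (2.49) p.264, (3.65)–(3.67) p.283, p.283] -/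
theorem ineq249_action23_chainWitness_of_supply_of_obligations (σ : Sect3Supplier θ p) (hprov : θ.Provisos₁₃CoPH F N)
    (hsel : θ.ppSel = ppSelLiveOfRecord F N θ.ν θ.τ9 (EOfRecord₁₃ F N θ.toStage13Params) (wOfRecord₉ F N θ.toStage9Params))
    (hθ : θ.Admissible F N) (hE₀ : 0 ≤ θ.s2.lf.E₀) (hB₀ : 0 ≤ θ.s2.lf.B₀) (hM : 1 ≤ θ.τ9.M)
    (hκ : kappa₀ (4 * 2 ^ (F.P p.K).d) (2 * (F.P p.K).d) ≤ θ.s2.lf.κ)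
    (hσ : SupplierObligations θ p σ) (hT : NoExpansionObligation θ p σ)
    {β cE κR cR : ℝ} {κ₀ : ℕ}
    (hES : Thm2ESupplyAt θ p (fun k s => (chainWitness θ p σ k).1 s) 𝒰 (1 - β) cE) (hRS : Thm2RSupplyAt θ p (fun k s => (chainWitness θ p σ k).1 s) 𝒰 κR cR κ₀)
    (H033 : Flow → ℕ → Prop) (hβ1 : β < 1) (hβ0 : 0 < β) (hκ7 : 7 ≤ κ₀)
    (h033 : H033 (flowOfRun (gOfRecord₁₃ F N θ.toStage13Params p)) p.K) (hg : ∀ j, j ≤ p.K → 0 ≤ gOfRecord₁₃ F N θ.toStage13Params p j)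
    (h𝒰 : ∀ k (s : SeqOfRecord F θ.ν θ.τ9.M (gOfRecord₁₃ F N θ.toStage13Params p) p.K k) (U : GaugeField (F.P p.K) 0 (SU N)), U ∈ 𝒰 k s →
      ∀ j, 1 ≤ j → j ≤ k → ∀ X, Sect2.admB (F.P p.K) θ.ν θ.τ9.M (gOfRecord₁₃ F N θ.toStage13Params p) s.Ω s.Λ j (Sect2.domSites (F.P p.K) θ.τ9.M j X) = true →
        Sect2.ofBackgroundC (ιSU N) U ∈ Sect2.spaceMS (settingOfRecord₁₃ F N θ.toStage13Params p) (θ.rzAt p s) θ.τ9.M j (Sect2.domSites (F.P p.K) θ.τ9.M j X) s.Ω) :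
    ∃ E₁ R₁ : ℝ, 0 ≤ E₁ ∧ 0 ≤ R₁ ∧
      ∀ k, k ≤ p.K → ∀ (s : SeqOfRecord F θ.ν θ.τ9.M (gOfRecord₁₃ F N θ.toStage13Params p) p.K k) (U : GaugeField (F.P p.K) 0 (SU N)), U ∈ 𝒰 k s →
      ∀ (a : Tk.SFluct (F.P p.K) (FluctV N)) (Ek EkLog EkRest : ℝ), Ek = EkLog + EkRest → ∀ (E₂ : ℝ) (Γ : ℕ → ℝ),
      (∀ n, 1 ≤ n → n ≤ k → ((univ.filter fun y : Site (F.P p.K) n => toFine n y ∈ gammaRegion s.Ω k n).card : ℝ) ≤ Γ n) →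
      (∀ n, 1 ≤ n → n ≤ k →
        ((univ.filter fun c : TPt (F.P p.K).d (Sect2.domCount (F.P p.K) θ.τ9.M n) =>
            (Sect2.domSites (F.P p.K) θ.τ9.M n (Sect2.cubeDom (F.P p.K) θ.τ9.M n c) ∩
                Sect2.enlT (F.P p.K) (Sect2.zSide (F.P p.K) θ.ν θ.τ9.M (gOfRecord₁₃ F N θ.toStage13Params p) n) 1 (s.Λ n)ᶜ).Nonempty ∧
              ∃ c', (c' = c ∨ TAdj c' c) ∧ (Sect2.domSites (F.P p.K) θ.τ9.M n (Sect2.cubeDom (F.P p.K) θ.τ9.M n c') ∩ s.Ω n).Nonempty).card : ℝ) ≤ Γ n) →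
      (∀ n, 1 ≤ n → n ≤ k → ∑ j ∈ Icc 1 n, (gOfRecord₁₃ F N θ.toStage13Params p j) ^ κ₀ ≤ (gOfRecord₁₃ F N θ.toStage13Params p n) ^ (κ₀ - 6)) →
      (∀ n, 1 ≤ n → n ≤ k → R₁ * (gOfRecord₁₃ F N θ.toStage13Params p n) ^ (κ₀ - 6) ≤ 1) →
      VacuumRestBound EkRest E₂ Γ k →
      Ineq249 ((sect2ActionDataOfRecord F N (FluctV N) p.K (settingOfRecord₁₃ F N θ.toStage13Params p) (θ.rzAt p s) s ((chainWitness θ p σ k).1 s) a Ek).action23 k U)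
        (smearedWilson (invSq (flowOfRun (gOfRecord₁₃ F N θ.toStage13Params p)) (θ.Phih p k s.Ω s.Λ) k) U) (-EkLog)
        (E₁ * (1 - ((F.P p.K).L : ℝ) ^ (-β))⁻¹ + 1 + 2 * (θ.s2.lf.B₀ * K₀ (4 * 2 ^ (F.P p.K).d) (2 * (F.P p.K).d)) + E₂) Γ k :=
  have hL : (1 : ℝ) < ((F.P p.K).L : ℝ) := by exact_mod_cast (F.P p.K).hL.2
  ineq249_action23_chainWitness_of_obligations θ p σ 𝒰 hprov hsel hθ hE₀ hB₀ hM hκ hσ hT H033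
    (thm2Printed_keyed_of_supply θ p _ 𝒰 H033 hM hg hES hRS) hβ1 hβ0 hL hκ7 h033 hg h𝒰

open Classical in
/-- **★★ Its constant-coupling UPPER half** (dag-n13-w3's `h249up` currency) from the supply tokens — g2's `action23_chainWitness_le_of_obligations` with Theorem 2 keyed produced
from the tokens. [cite: Balaban1988Convergent, (2.49)–(2.50) p.264, Thm 2 p.263] -/
theorem action23_chainWitness_le_of_supply_of_obligations (σ : Sect3Supplier θ p) (hprov : θ.Provisos₁₃CoPH F N)
    (hsel : θ.ppSel = ppSelLiveOfRecord F N θ.ν θ.τ9 (EOfRecord₁₃ F N θ.toStage13Params) (wOfRecord₉ F N θ.toStage9Params))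
    (hθ : θ.Admissible F N) (hE₀ : 0 ≤ θ.s2.lf.E₀) (hB₀ : 0 ≤ θ.s2.lf.B₀) (hM : 1 ≤ θ.τ9.M)
    (hκ : kappa₀ (4 * 2 ^ (F.P p.K).d) (2 * (F.P p.K).d) ≤ θ.s2.lf.κ)
    (hσ : SupplierObligations θ p σ) (hT : NoExpansionObligation θ p σ)
    {β cE κR cR : ℝ} {κ₀ : ℕ}
    (hES : Thm2ESupplyAt θ p (fun k s => (chainWitness θ p σ k).1 s) 𝒰 (1 - β) cE) (hRS : Thm2RSupplyAt θ p (fun k s => (chainWitness θ p σ k).1 s) 𝒰 κR cR κ₀)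
    (H033 : Flow → ℕ → Prop) (hβ1 : β < 1) (hβ0 : 0 < β) (hκ7 : 7 ≤ κ₀)
    (h033 : H033 (flowOfRun (gOfRecord₁₃ F N θ.toStage13Params p)) p.K) (hg : ∀ j, j ≤ p.K → 0 ≤ gOfRecord₁₃ F N θ.toStage13Params p j)
    (h𝒰 : ∀ k (s : SeqOfRecord F θ.ν θ.τ9.M (gOfRecord₁₃ F N θ.toStage13Params p) p.K k) (U : GaugeField (F.P p.K) 0 (SU N)), U ∈ 𝒰 k s →
      ∀ j, 1 ≤ j → j ≤ k → ∀ X, Sect2.admB (F.P p.K) θ.ν θ.τ9.M (gOfRecord₁₃ F N θ.toStage13Params p) s.Ω s.Λ j (Sect2.domSites (F.P p.K) θ.τ9.M j X) = true →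
        Sect2.ofBackgroundC (ιSU N) U ∈ Sect2.spaceMS (settingOfRecord₁₃ F N θ.toStage13Params p) (θ.rzAt p s) θ.τ9.M j (Sect2.domSites (F.P p.K) θ.τ9.M j X) s.Ω) :
    ∃ E₁ R₁ : ℝ, 0 ≤ E₁ ∧ 0 ≤ R₁ ∧
      ∀ k, k ≤ p.K → ∀ (s : SeqOfRecord F θ.ν θ.τ9.M (gOfRecord₁₃ F N θ.toStage13Params p) p.K k) (U : GaugeField (F.P p.K) 0 (SU N)), U ∈ 𝒰 k s →
      (∀ j, 1 ≤ j → j ≤ k → 0 ≤ 1 / gOfRecord₁₃ F N θ.toStage13Params p (j - 1) ^ 2 - 1 / gOfRecord₁₃ F N θ.toStage13Params p j ^ 2) →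
      (∀ j, 1 ≤ j → j ≤ k → ∀ x, θ.Phih p k s.Ω s.Λ j x ≤ 1) →
      ∀ (a : Tk.SFluct (F.P p.K) (FluctV N)) (Ek EkLog EkRest : ℝ), Ek = EkLog + EkRest → ∀ (E₂ : ℝ) (Γ : ℕ → ℝ),
      (∀ n, 1 ≤ n → n ≤ k → ((univ.filter fun y : Site (F.P p.K) n => toFine n y ∈ gammaRegion s.Ω k n).card : ℝ) ≤ Γ n) →
      (∀ n, 1 ≤ n → n ≤ k →
        ((univ.filter fun c : TPt (F.P p.K).d (Sect2.domCount (F.P p.K) θ.τ9.M n) =>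
            (Sect2.domSites (F.P p.K) θ.τ9.M n (Sect2.cubeDom (F.P p.K) θ.τ9.M n c) ∩
                Sect2.enlT (F.P p.K) (Sect2.zSide (F.P p.K) θ.ν θ.τ9.M (gOfRecord₁₃ F N θ.toStage13Params p) n) 1 (s.Λ n)ᶜ).Nonempty ∧
              ∃ c', (c' = c ∨ TAdj c' c) ∧ (Sect2.domSites (F.P p.K) θ.τ9.M n (Sect2.cubeDom (F.P p.K) θ.τ9.M n c') ∩ s.Ω n).Nonempty).card : ℝ) ≤ Γ n) →
      (∀ n, 1 ≤ n → n ≤ k → ∑ j ∈ Icc 1 n, (gOfRecord₁₃ F N θ.toStage13Params p j) ^ κ₀ ≤ (gOfRecord₁₃ F N θ.toStage13Params p n) ^ (κ₀ - 6)) →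
      (∀ n, 1 ≤ n → n ≤ k → R₁ * (gOfRecord₁₃ F N θ.toStage13Params p n) ^ (κ₀ - 6) ≤ 1) →
      VacuumRestBound EkRest E₂ Γ k →
      (sect2ActionDataOfRecord F N (FluctV N) p.K (settingOfRecord₁₃ F N θ.toStage13Params p) (θ.rzAt p s) s ((chainWitness θ p σ k).1 s) a Ek).action23 k U ≤
        -(1 / (gOfRecord₁₃ F N θ.toStage13Params p k) ^ 2 * wilsonAction4 U) - EkLog +
          (E₁ * (1 - ((F.P p.K).L : ℝ) ^ (-β))⁻¹ + 1 + 2 * (θ.s2.lf.B₀ * K₀ (4 * 2 ^ (F.P p.K).d) (2 * (F.P p.K).d)) + E₂) * ∑ n ∈ Icc 1 k, Γ n :=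
  have hL : (1 : ℝ) < ((F.P p.K).L : ℝ) := by exact_mod_cast (F.P p.K).hL.2
  action23_chainWitness_le_of_obligations θ p 𝒰 σ hprov hsel hθ hE₀ hB₀ hM hκ hσ hT H033
    (thm2Printed_keyed_of_supply θ p _ 𝒰 H033 hM hg hES hRS) hβ1 hβ0 hL hκ7 h033 hg h𝒰

/-! ## §3. A6: the tokens at the empty class -/

/-- At the EMPTY configuration class the 𝐄-side token holds for any `cE ≥ 0` (no datum): the tokens are consistent propositions; the inhabitant at a non-empty class is
[III] §3's analysis itself — LOCATED, nobody's theorem. [cite: Balaban1988Convergent, (3.67) p.283 (bookkeeping)] -/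
theorem thm2ESupplyAt_empty {b cE : ℝ} (hcE : 0 ≤ cE) :
    Thm2ESupplyAt θ p 𝒯 (fun _ _ => (∅ : Set (GaugeField (F.P p.K) 0 (SU N)))) b cE :=
  ⟨hcE, fun _ _ _ _ hU => absurd hU (Set.notMem_empty _)⟩

/-- At the EMPTY configuration class the 𝐑-side token holds for any `cR ≥ 0`, `κ ≥ κ₀(4·2^d, 2d)`. [cite: Balaban1988Convergent, p.283 (bookkeeping)] -/
theorem thm2RSupplyAt_empty {κ cR : ℝ} {κ₀ : ℕ} (hcR : 0 ≤ cR) (hκ : kappa₀ (4 * 2 ^ (F.P p.K).d) (2 * (F.P p.K).d) ≤ κ) :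
    Thm2RSupplyAt θ p 𝒯 (fun _ _ => (∅ : Set (GaugeField (F.P p.K) 0 (SU N)))) κ cR κ₀ :=
  ⟨hcR, hκ, fun _ _ _ _ hU => absurd hU (Set.notMem_empty _)⟩

end Summit.QuantumFields.YangMills.Theorems.BalabanUVNodesN11Thm2SupplyDefs

end
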